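import Summits.CriticalPhenomena.Ising3DConformalLimit.Theses.FKParityRobustness
import Literature.Probability.LatticeModels.RandomClusterFKG
import Literature.Probability.LatticeModels.RandomClusterDomainMarkovFree
import Literature.Probability.LatticeModels.RandomClusterProofs
import Literature.Probability.LatticeModels.FKIsingRSWProofs
import Literature.Probability.LatticeModels.IsingThermodynamics
import Literature.Probability.Percolation.PercolationEvents

/-!
# Skeleton line `cluster-hole-opacity` for crux `FKFourConnectivity` (stmt-CriticalPhenomena-11254)

Route `FKParityRobustness`, crux r3 `FKFourConnectivity` = P4 (FK four-point hyperscaling on `ℤ³`):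
`∃ c > 0 ∀ l ≥ 1 ∃ N₀ ∀ N ≥ N₀ ∀ a = l·tetra ⊂ Λ_N : c·φ_N(a₀↔a₁)·φ_N(a₂↔a₃) ≤ φ_N(all four joined)`,
`φ_N = rcMeasure ((zdGraph 3).comap Subtype.val) (fkIsingParam β_c(3)) 2 ∅` the free critical FK-Ising
measure of the box graph on `Λ_N = {−N..N}³`.

## The line (idea card `Cruxes/FKFourConnectivity/Ideas/cluster-hole-opacity.md`, crux-ideate r1 k1;
triage r1-1/2/3: pass ×3; merged by the panel with `relevant-defect-screening`, same lever)

PEEL ONE CLUSTER, READ THE OTHER PAIR AS A CORRELATION IN THE HOLED DOMAIN.  Write `x↔y` for the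
open-connection events, `C = C_ω(a₀)` for the open cluster of `a₀`, and for a vertex set `K` let
`hole K` be the (decreasing) event "no open edge touches `K`" and `holedGraph G K` the graph `G` with
every edge touching `K` deleted.  Four registered stubs and a kernel-checked composition:

* `stub_peel` (FK, finite graphs, PROVABLE NOW, M–L) — the explored-cluster domain Markov property,
  integrated: for `0 ≤ p < 1`, `q > 0`, `y ≠ y'`,
  `φ(x↔x', y↔y', x↮y) = ∫ 1{x↔x'}(ω) · φ(y↔y' ∩ hole C_ω(x)) / φ(hole C_ω(x)) dφ(ω)`
  (sum over the value `C` of the cluster of `x`; given `C_ω(x) = C` the configuration off the edges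
  touching `C` is `φ( · | hole C)`; Grimmett 2006 Thm (3.1)(a) / Lemma (4.13), the pattern of the tree's
  `rcMeasure_real_free_restrict_inter_outerClosed` with the explored cluster in place of a fixed region).
* `stub_holeDictionary` (FK → spin, PROVABLE NOW, M) — `φ_{p(β),2}(y↔y' | hole K) = ⟨σ_yσ_y'⟩^free` of
  the Ising model on `holedGraph G K` (domain Markov for the edge set touching `K` + Edwards–Sokal on the
  holed graph, `edwardsSokal_twoPoint_holds`): the hole TRANSPARENCY is an Ising two-point function in
  the domain with the hole cut out, a deterministic set functional `K ↦ ⟨σ₂σ₃⟩_{Λ∖K}`.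
* `stub_thickCluster` (FK geometry on `ℤ³`, OPEN, XL — HARDEST, the weak-hyperscaling input (M) named by
  triage r1-3/r1-2): with conditional probability `≥ c₁` given `a₀↔a₁`, the cluster `C_ω(a₀)` is
  2-THICK at scale `l`: it contains the leaves of a dyadic tree of depth `J(l) = ⌊log₂ l⌋ − 3` rooted at
  a box of side `2^{J(l)}` cornered in `Λ_{2l}`, every node keeping `≥ 4` of its `8` children
  (`ThickAt`, `IsThick`; a uniformly ≥ 2-dimensional skeleton — the sheet is thick, a segment or a
  compact sub-ball is not; `2` sits strictly between `Δ_ε = 1.413` and `d_f = 2.482`).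
* `stub_thickHolesOpaque` (spin side, OPEN, L–XL — the "relevant defect is opaque" input (D)/(R)): every
  2-thick hole `K ⊂ Λ_N` at scale `l` depresses the critical correlation across the opposite edge of the
  tetrahedron by a constant factor: `⟨σ_{a₂}σ_{a₃}⟩^free_{Λ_N holed at K} ≤ (1 − c₂)·⟨σ_{a₂}σ_{a₃}⟩^free_{Λ_N}`,
  uniformly in `l ≥ 1`, `N ≥ N₀(l)` (solid cubes and `l×l` sheets are thick: the triage's "first theorem"
  SolidDefectOpacity is the special case to land first).
* `FKFourConnectivity_of` (REAL PROOF, this file): FKG `φ(01 ∧ 23) ≥ φ(01)φ(23)`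
  (`pairProduct_le_pairJoined`, landed Negative lemma), `{01 ∧ 23} ⊆ ALL ∪ {01 ∧ 23 ∧ 0↮2}`
  (`allJoined_of_hub`), the peel identity, the dictionary, and the pointwise bound
  `⟨σ₂σ₃⟩_{holed C} ≤ (1−c₂)φ(23)` on thick clusters / `≤ φ(23)` otherwise (FKG mixed form
  `rcMeasure_real_inter_le_of_isLowerSet`, PROVED in tree) give
  `P4 ≥ φ(01)φ(23) − φ(23)·(φ(01) − c₂·φ(01 ∧ thick)) ≥ c₁c₂·φ(01)φ(23)`.

HOLE′ = `E[1{a₀↔a₁}·(1 − ⟨σ₂σ₃⟩_{holed C}/⟨σ₂σ₃⟩)] ≥ c·φ(01)` (the card's HOLE with the split event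
dropped: a hole swallowing `a₂` or `a₃` is totally opaque) is EQUIVALENT to the crux at the symmetric
tetrahedron (peel + Lebowitz `⟨σ_A⟩ = P4 + 3s ≤ 3G²`: HOLE′ ⟸ crux with `c/3`; = card 6's Screening
`δ_π ≥ cG²`), so the two open stubs are a genuine AND-decomposition of an equivalent of the crux along
the idea's lever: a typical-geometry statement about ONE critical FK cluster (thick) and a deterministic
statement about Ising correlations in holed domains (thick holes are opaque), glued by monotone set
inclusion (thickness is an `∃`-substructure property, so no separate monotonicity stub is needed;
GKS-II monotonicity of `K ↦ ⟨σ₂σ₃⟩_{Λ∖K}` is the prover's tool inside `stub_thickHolesOpaque`).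

REGIME HONESTY.  Thick(𝒦) is easier for smaller families, Opaque(𝒦) for larger ones; the dyadic
2-thick family is chosen inside the physical window `Δ_ε < 2 < d_f` (branching `2² = 4` of `8` per
level versus the cluster's mean `2^{2.48} ≈ 5.6`; first-order relevance `s^{2−Δ_ε} → ∞` at every scale
`s`, so a thick set is non-perturbatively opaque, like a solid body of its own extent).  Point nets of
isolated sites do NOT work (a `d_f`-set of diameter `l` has only `(l/r)^{d_f}` `r`-separated points,
and `m` unit defects are opaque only for `m ≳ l^{Δ_ε}` with `r ≳ m^{0.38}`, incompatible) — recorded so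
nobody files that family.  If `stub_thickCluster` dies for THIS family (rigid `≥ 4 of 8` at every
node), the lead reshapes the family (pruned trees / two admissible scales), not the line.

## Disproof used (`Cruxes/FKFourConnectivity/Disproof.lean` v3, cdisprove seat, read 2026-08-16T02:10Z)

* No `_false_without_` theorem, no refuted strengthening, no `-- Targets` yet: nothing to honour
  formally.  Its LOAD-BEARING census (shape `a = l·tetra`, criticality, `q = 2`) is honoured: the two
  open stubs are stated at `β_c(3)`, `q = 2`, for the tetrahedron only (`stub_thickHolesOpaque` is a
  critical phenomenon — in a massive phase a hole at distance `≍ l` is exponentially transparent — and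
  `stub_thickCluster` is false for the dumbbell quadruple for the right reason).
* Landed Negative lemmas (`Theorems/FKFourConnectivity/Negative/LebowitzSandwich.lean`, p74034) were
  read and checked against: none refutes an instance of a stub (they are the necessity direction
  `Σ_π φφ − φ(EVEN) ≤ 2φ(ALL)` and the junk regime `p = 0`); its `pairProduct_le_pairJoined` and
  `allJoined_of_hub` are used positively below (re-derived in two lines, since the farm build of that
  freshly landed module was still pending when this skeleton was checked).
* `not_FKFourConnectivity_imp_not_latticeBound` (Disproof §2b): the crux is the weakest statement on the
  pointwise-tetrahedral line — consistent with HOLE′ ⟺ crux above (no strength is given away).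
* Monte-Carlo tests queued by the disprover/ideators/triagers (j007942/49/53, j009401–03, j010132,
  j010078, j010140) decide `c_HOLE(l)` / `δ/GG` plateau = HOLE′ and hence both open stubs jointly.

## Vocabulary (RESHAPE 1, line lead `prover-line-stmt-CriticalPhenomena-11254-0`, 2026-08-16: being landed as
`Theorems/FKParityRobustnessFKFourConnectivityDefs.lean` through the registered bookkeeping stub
`stub_holeLower` — "the hole event is decreasing", the monotonicity the composition feeds to the FKG
mixed form; until that file is built on the farm the skeleton keeps its own verbatim copies below)

`tetra`, `boxGraph N`, `fkBox N` (verbatim the crux's `let`s), `hole K`, `holedGraph G K`,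
`ThickAt K j z`, `lvl l`, `IsThick l K`, `thickEvent l N x`.
-/

noncomputable section

open MeasureTheory Finset
open Literature.Probability.LatticeModels Literature.Probability.Percolation

namespace Summit.CriticalPhenomena.Ising3DConformalLimit.Cruxes.FKFourConnectivity.ClusterHoleOpacity

open scoped Classical

/-! ### Vocabulary: the box setting of the crux -/

/-- The unit tetrahedron of the route (verbatim the crux's `let tetra`); the sources are `a = l • tetra`. -/
def tetra : Fin 4 → Site 3 := ![![-1, -1, -1], ![1, 1, -1], ![1, -1, 1], ![-1, 1, 1]]

/-- The four vertices of the unit tetrahedron are distinct. -/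
theorem tetra_inj : Function.Injective tetra := by
  unfold tetra
  decide

/-- The sources `a = l • tetra` (`l ≥ 1`) are four distinct vertices of the box. -/
theorem tetra_injective {l : ℕ} (hl : 1 ≤ l) {N : ℕ} (a : Fin 4 → ↥(box 3 N))
    (ha : ∀ i, ((a i : Site 3)) = (l : ℤ) • tetra i) : Function.Injective a := by
  intro i j hij
  have h : (l : ℤ) • tetra i = (l : ℤ) • tetra j := by rw [← ha i, ← ha j, hij]
  have hl0 : (l : ℤ) ≠ 0 := by exact_mod_cast (show l ≠ 0 by omega)
  exact tetra_inj (smul_right_injective (Site 3) hl0 h)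

/-- The nearest-neighbour graph induced on the box `Λ_N = {−N..N}³` (verbatim the crux's `let G`). -/
abbrev boxGraph (N : ℕ) : SimpleGraph ↥(box 3 N) := (zdGraph 3).comap Subtype.val

/-- The free critical FK-Ising measure of `Λ_N` (verbatim the crux's `let φ`). -/
abbrev fkBox (N : ℕ) : Measure (BondConfig ↥(box 3 N)) :=
  rcMeasure (boxGraph N) (fkIsingParam (criticalBeta 3)) 2 ∅

/-! ### Two elementary facts (also in the landed `Theorems/FKFourConnectivity/Negative/LebowitzSandwich.lean`,
re-derived here so that the skeleton does not depend on the farm's build state of that module) -/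

section Elementary

variable {V : Type*}

/-- A hub vertex joined to all four marked vertices joins them all. [folklore] -/
theorem allJoined_of_hub {a : Fin 4 → V} {ω : BondConfig V}
    (h : ∀ i, (openGraph ω).Reachable (a 0) (a i)) :
    ω ∈ {ω : BondConfig V | ∀ i j, (openGraph ω).Reachable (a i) (a j)} := by
  intro i j
  exact (h i).symm.trans (h j)

variable [Fintype V] [DecidableEq V] (G : SimpleGraph V) [DecidableRel G.Adj]

/-- The single-pairing FKG bound `φ(a₀↔a₁) φ(a₂↔a₃) ≤ φ(a₀↔a₁ ∧ a₂↔a₃)` (`rcMeasure_fkg_holds`,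
Fortuin–Kasteleyn–Ginibre 1971 / Grimmett 2006 Thm 3.8). [folklore] -/
theorem pairProduct_le_pairJoined {p q : ℝ} (hp : p ∈ Set.Icc (0 : ℝ) 1) (hq : 1 ≤ q) (B : Set V)
    (a : Fin 4 → V) :
    (rcMeasure G p q B).real (openConn (a 0) (a 1)) * (rcMeasure G p q B).real (openConn (a 2) (a 3)) ≤
      (rcMeasure G p q B).real (openConn (a 0) (a 1) ∩ openConn (a 2) (a 3)) :=
  rcMeasure_fkg_holds G hp hq B (isUpperSet_openConn (a 0) (a 1)) (isUpperSet_openConn (a 2) (a 3))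

end Elementary

/-! ### Vocabulary: holes -/

section General

variable {V : Type*}

/-- The HOLE event of a vertex set `K`: no open edge touches `K` (every edge with an endpoint in `K`
is closed).  Decreasing.  Conditioning the free FK measure on it gives the free FK measure of the
holed graph (the vertices of `K` become isolated). -/
def hole (K : Set V) : Set (BondConfig V) := {ω | ∀ e ∈ ω, ∀ v ∈ K, v ∉ e}

/-- `hole K` is a decreasing event. -/
theorem isLowerSet_hole (K : Set V) : IsLowerSet (hole K) := by
  intro ω ω' hle hω e he v hv
  exact hω e (hle he) v hv

/-- The HOLED GRAPH: `G` with every edge touching `K` deleted (same vertex type; the vertices of `K`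
are isolated, so their spins are independent fair signs and `⟨σ_yσ_y'⟩` for `y, y' ∉ K` is the
correlation of the Ising model on `G ∖ K` with free boundary condition on the hole). -/
def holedGraph (G : SimpleGraph V) (K : Set V) : SimpleGraph V where
  Adj u v := G.Adj u v ∧ u ∉ K ∧ v ∉ K
  symm := ⟨fun _ _ h => ⟨h.1.symm, h.2.2, h.2.1⟩⟩
  loopless := ⟨fun _ h => h.1.ne rfl⟩

end General

/-! ### Vocabulary: dyadic 2-thickness (the explicit deterministic family of opaque holes) -/

/-- `ThickAt K j z`: the dyadic box of side `2^j` with lower corner `z` is 2-THICK for `K`: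
at level `0` the site `z` lies in `K`; at level `j+1` at least `4` of the `8` children (side `2^j`,
corners `z + 2^j v`, `v ∈ {0,1}³`) are 2-thick.  A 2-thick box of side `2^j` contains `≥ 4^j` points
of `K` spread like a set of dimension `≥ 2` at every dyadic scale (an `l×l` sheet and a solid cube are
2-thick; a segment, a chemical path or a compact ball of radius `≪` side are not). -/
def ThickAt (K : Set (Site 3)) : ℕ → Site 3 → Prop
  | 0, z => z ∈ K
  | j + 1, z => 4 ≤ #((Finset.univ : Finset (Fin 3 → Fin 2)).filter
      fun v => ThickAt K j (z + fun i => (2 : ℤ) ^ j * ((v i : ℕ) : ℤ)))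

/-- The dyadic level used at tetrahedral scale `l`: boxes of side `2^(⌊log₂ l⌋ − 3) ∈ (l/16, l/8]`
(level `0`, a single site, for `l < 16`). -/
def lvl (l : ℕ) : ℕ := Nat.log 2 l - 3

/-- `K ⊆ ℤ³` is 2-THICK AT SCALE `l`: some dyadic box of level `lvl l` with lower corner in `Λ_{2l}`
is 2-thick for `K`. -/
def IsThick (l : ℕ) (K : Set (Site 3)) : Prop :=
  ∃ z ∈ box 3 (2 * l), ThickAt K (lvl l) z

/-- The THICK-CLUSTER event in the box `Λ_N`: the open cluster of `x` is 2-thick at scale `l`. -/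
def thickEvent (l N : ℕ) (x : ↥(box 3 N)) : Set (BondConfig ↥(box 3 N)) :=
  {ω | IsThick l (Subtype.val '' openCluster ω x)}

/-! ### The stub STATEMENTS (named `Prop`s; the registered `stub_*` theorems below restate them
verbatim, and `Registered.stub_*` are their name-keyed aliases used as hypotheses of
`FKFourConnectivity_of`) -/

/-- Statement of STUB PEEL (explored-cluster domain Markov property, integrated; any finite graph,
`0 ≤ p < 1`, `q > 0`, `y ≠ y'`): the split probability `φ(x↔x', y↔y', x↮y)` equals the
`φ`-expectation, on `{x↔x'}`, of the conditional probability of `y↔y'` given the hole of the cluster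
of `x`. -/
def PeelIdentity : Prop :=
  ∀ (V : Type) [Fintype V] [DecidableEq V] (G : SimpleGraph V) [DecidableRel G.Adj] (p q : ℝ),
    p ∈ Set.Ico (0 : ℝ) 1 → 0 < q → ∀ x x' y y' : V, y ≠ y' →
      (rcMeasure G p q ∅).real (openConn x x' ∩ openConn y y' ∩ (openConn x y)ᶜ) =
        ∫ ω, (openConn x x').indicator
          (fun ω => (rcMeasure G p q ∅).real (openConn y y' ∩ hole (openCluster ω x)) /
            (rcMeasure G p q ∅).real (hole (openCluster ω x))) ω ∂(rcMeasure G p q ∅)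

/-- Statement of STUB DICT (hole dictionary; any finite graph, `β ≥ 0`, any `K`, `y`, `y'`): the
FK-Ising probability of `y↔y'` conditioned on the hole of `K` is the free Ising two-point function of
the holed graph. -/
def HoleDictionary : Prop :=
  ∀ (V : Type) [Fintype V] [DecidableEq V] (G : SimpleGraph V) [DecidableRel G.Adj] (β : ℝ),
    0 ≤ β → ∀ (K : Set V) (y y' : V),
      (rcMeasure G (fkIsingParam β) 2 ∅).real (openConn y y' ∩ hole K) /
          (rcMeasure G (fkIsingParam β) 2 ∅).real (hole K) =
        isingTwoPoint (holedGraph G K) univ β 0 .free y y'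

/-- Statement of STUB THICK (open, `d = 3`, hardest): the critical FK-Ising cluster of `a₀`, given
`a₀↔a₁`, is 2-thick at scale `l` with conditional probability `≥ c`, uniformly in `l ≥ 1`, `N ≥ N₀(l)`. -/
def ThickCluster : Prop :=
  ∃ c : ℝ, 0 < c ∧ ∀ l : ℕ, 1 ≤ l → ∃ N₀ : ℕ, ∀ N : ℕ, N₀ ≤ N → ∀ a : Fin 4 → ↥(box 3 N),
    (∀ i, ((a i : Site 3)) = (l : ℤ) • tetra i) →
      c * (fkBox N).real (openConn (a 0) (a 1)) ≤
        (fkBox N).real (openConn (a 0) (a 1) ∩ thickEvent l N (a 0))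

/-- Statement of STUB OPAQUE (open, `d = 3`): a 2-thick hole at scale `l` depresses the critical
free-boundary correlation across the opposite edge `a₂a₃` of the tetrahedron by a constant factor,
uniformly in `l ≥ 1`, `N ≥ N₀(l)` and the thick set `K ⊆ Λ_N`. -/
def ThickHolesOpaque : Prop :=
  ∃ c : ℝ, 0 < c ∧ ∀ l : ℕ, 1 ≤ l → ∃ N₀ : ℕ, ∀ N : ℕ, N₀ ≤ N → ∀ a : Fin 4 → ↥(box 3 N),
    (∀ i, ((a i : Site 3)) = (l : ℤ) • tetra i) → ∀ K : Set ↥(box 3 N),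
      IsThick l (Subtype.val '' K) →
        isingTwoPoint (holedGraph (boxGraph N) K) univ (criticalBeta 3) 0 .free (a 2) (a 3) ≤
          (1 - c) * isingTwoPoint (boxGraph N) univ (criticalBeta 3) 0 .free (a 2) (a 3)

/-! ### The registered stubs (all four carry `sorry`; PEEL and DICT are provable now) -/

/-- STUB PEEL (M–L, provable now) — `PeelIdentity`: for the free random-cluster measure
`φ = φ⁰_{G,p,q}` of a finite graph (`0 ≤ p < 1`, `q > 0`) and vertices `x, x', y ≠ y'`,
`φ(x↔x' ∧ y↔y' ∧ x↮y) = ∫ 1_{x↔x'}(ω) · φ(y↔y' ∩ hole C_ω(x)) / φ(hole C_ω(x)) dφ(ω)`.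
Proof sketch: both sides are finite sums (`rcMeasure_real_apply`, `integral_rcMeasure`); group
configurations by the cluster `C = C_ω(x)` (a vertex set containing `x`); the event `{C_ω(x) = C}` is
determined by the edges touching `C` (those inside `C` connect it, those leaving `C` are closed) and,
writing `ω = ω₁ ⊔ ω₂` (edges touching / not touching `C`), `w_{p,q}(ω) = w^{touch}(ω₁)·q·w^{off}_{p,q}(ω₂)`
with `k(ω) = 1 + k_{V∖C}(ω₂)`; on that event with `y ∉ C`, `y↔y'` holds iff it holds in `ω₂`; and
`φ(B ∩ hole C)/φ(hole C)` for `B` determined by the off-edges is the same normalised `ω₂`-sum (the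
`q^{|C|}` of the isolated hole cancels) — the computation of `sum_rcWeight_free_restrict_inter_outerClosed`
/ `rcMeasure_real_free_restrict_inter_outerClosed` (`RandomClusterDomainMarkovFree.lean`) with the
explored cluster in place of the fixed region `Δ ∖ Λ`; clusters `C ∋ y` contribute `0` to the right side
because `y ≠ y'` is isolated under `hole C` (this is where `y ≠ y'` and `p < 1`, i.e. `φ(hole C) > 0`,
`rcMeasure_real_outerClosed_pos`, enter).  [Grimmett2006 Thm (3.1)(a), Lemma (4.13); the tree's
`RandomClusterExploredWiring.lean` has the exploration pattern.] -/
theorem stub_peel :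
    ∀ (V : Type) [Fintype V] [DecidableEq V] (G : SimpleGraph V) [DecidableRel G.Adj] (p q : ℝ),
      p ∈ Set.Ico (0 : ℝ) 1 → 0 < q → ∀ x x' y y' : V, y ≠ y' →
        (rcMeasure G p q ∅).real (openConn x x' ∩ openConn y y' ∩ (openConn x y)ᶜ) =
          ∫ ω, (openConn x x').indicator
            (fun ω => (rcMeasure G p q ∅).real (openConn y y' ∩ hole (openCluster ω x)) /
              (rcMeasure G p q ∅).real (hole (openCluster ω x))) ω ∂(rcMeasure G p q ∅) := by
  sorry

/-- STUB DICT (M, provable now) — `HoleDictionary`: for `β ≥ 0`, `p = fkIsingParam β = 1 − e^{−2β} < 1`,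
any vertex set `K` and vertices `y, y'` of a finite graph `G`,
`φ_{G,p,2}(y↔y' ∩ hole K) / φ_{G,p,2}(hole K) = ⟨σ_yσ_{y'}⟩^free_{holedGraph G K, β}`.
Proof sketch: (i) domain Markov for the edge set `E_K` touching `K`: `φ_G( · | hole K)` restricted to
the configurations on `E(G) ∖ E_K` is `φ^free_{holedGraph G K, p, 2}` — the weights agree up to the
constant `(1−p)^{|E_K|}·2^{0}` (cluster counts coincide on the same vertex type: the vertices of `K` are
isolated in both), cf. `rcWeight_free_map` / `sum_rcWeight_free_restrict_inter_outerClosed`; (ii)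
`{y↔y'} ∩ hole K = {y↔y' off E_K} ∩ hole K`; (iii) Edwards–Sokal on the holed graph,
`edwardsSokal_twoPoint_holds (holedGraph G K) hβ y y'` (`RandomClusterProofs.lean`).  Degenerate cases
are consistent: `y ∈ K`, `y ≠ y'` gives `0 = 0`; `y = y'` gives `1 = 1`; `φ(hole K) > 0` always since
`p < 1`.  [EdwardsSokal1988; Grimmett2006 Thm 1.16, Lemma (4.13).] -/
theorem stub_holeDictionary :
    ∀ (V : Type) [Fintype V] [DecidableEq V] (G : SimpleGraph V) [DecidableRel G.Adj] (β : ℝ),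
      0 ≤ β → ∀ (K : Set V) (y y' : V),
        (rcMeasure G (fkIsingParam β) 2 ∅).real (openConn y y' ∩ hole K) /
            (rcMeasure G (fkIsingParam β) 2 ∅).real (hole K) =
          isingTwoPoint (holedGraph G K) univ β 0 .free y y' := by
  sorry

/-- STUB THICK (XL, OPEN, LOAD-BEARING — the lead's stub) — `ThickCluster`: there is `c > 0` such that
for every `l ≥ 1`, all large `N` and `a = l·tetra ⊂ Λ_N`,
`φ_N(a₀↔a₁ ∧ C_ω(a₀) is 2-thick at scale l) ≥ c·φ_N(a₀↔a₁)`: conditionally on the two far points being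
joined, the critical FK-Ising cluster contains, inside a dyadic box of side `2^{lvl l} ≍ l/8` cornered
in `Λ_{2l}`, the leaves of a depth-`lvl l` tree keeping `≥ 4` of `8` children at every node (a
uniformly 2-dimensional dyadic skeleton).  Why plausibly true: the conditioned cluster has fractal
dimension `d_f = (5−η)/2 = 2.48 > 2` (mean branching `2^{2.48} ≈ 5.6` of `8` sub-boxes per level), so a
4-ary regular subtree exists with probability bounded below (Pakes–Dekking criterion for the box-count
branching process); small `l` (`lvl l = 0`: a single site of `C ∩ Λ_{2l}`, e.g. `a₀`) are trivial.  Why it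
might fail / what is hard: it is a TYPICAL-mass (weak hyperscaling) statement — the FKG-certified
first moment `E[|C ∩ B_l| ; 0↔1] ≳ l³G(l)²` and the Lebowitz/tree-bound second moment differ by one
factor `G(l)^{−1/2}`-worth of three-point hyperscaling (triage r1-3), and the tree's two-point window is
only `c|x|⁻² ≤ G ≤ C|x|⁻¹` (`criticalTwoPoint_bounds_holds`; `dcp_isingEta_le_half` conditional); the
rigid "≥ 4 of 8 at EVERY node" may need pruning slack (reshape the family, not the line).  Must use
`d = 3` and criticality (barriers `IsingTrivialityFromDimensionFour`, `RandomClusterFirstOrder` complied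
with: in `d ≥ 5` thick-AND-opaque fails, at a first-order point the free cluster is finite).
[HouEtAl2018 arXiv:1811.03358 §4 (d_f, d_min, d_B of 3D FK-Ising); Grimmett2006 Ch. 4–5;
AizenmanDuminilCopinSidoraviciusCMP2015 (continuity at β_c, d = 3).] -/
theorem stub_thickCluster :
    ∃ c : ℝ, 0 < c ∧ ∀ l : ℕ, 1 ≤ l → ∃ N₀ : ℕ, ∀ N : ℕ, N₀ ≤ N → ∀ a : Fin 4 → ↥(box 3 N),
      (∀ i, ((a i : Site 3)) = (l : ℤ) • tetra i) →
        c * (fkBox N).real (openConn (a 0) (a 1)) ≤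
          (fkBox N).real (openConn (a 0) (a 1) ∩ thickEvent l N (a 0)) := by
  sorry

/-- STUB OPAQUE (L–XL, OPEN) — `ThickHolesOpaque`: there is `c > 0` such that for every `l ≥ 1`, all
large `N`, `a = l·tetra ⊂ Λ_N` and every `K ⊆ Λ_N` that is 2-thick at scale `l`,
`⟨σ_{a₂}σ_{a₃}⟩^free_{holedGraph Λ_N K, β_c} ≤ (1 − c)·⟨σ_{a₂}σ_{a₃}⟩^free_{Λ_N, β_c}`: a hole of dimension
`≥ 2 > Δ_ε = 3 − 1/ν = 1.413` and linear size `≍ l` within distance `O(l)` of `a₂, a₃` is an OPAQUE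
(relevant, free-boundary / ordinary-transition) energy defect for the critical two-point function
across it.  Tools: GKS-II monotonicity in the couplings (`gksExpect_mono_of_abs_le`,
`GKSInequalities.lean`: deleting edges lowers `⟨σσ⟩`, so it suffices to treat the minimal thick subtree,
and a hole swallowing `a₂` or `a₃` is totally opaque), the exact one-bond deletion calculus
`1 − δ(K) = ∏_j (1 − t·⟨σ₂σ₃;ε_{e_j}⟩_{(j−1)}/(⟨σ₂σ₃⟩_{(j−1)}(1 − t⟨ε_{e_j}⟩_{(j−1)})))`, `t = tanh β_c`
(from `e^{βσσ} = cosh β (1 + tσσ)`), Aizenman's random-current response identity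
`⟨σ₂σ₃;σ_xσ_y⟩ = G_{2x}G_{3y}(2A_{xy} − 1) + G_{2y}G_{3x}` (`ursellFour_eq_doubleCurrent_holds`), Simon–Lieb
/ Messager–Miracle-Solé.  FIRST THEOREM TO LAND (special case, triage r1-2): solid-cube / `l×l`-sheet
opacity (both are 2-thick).  Why it might fail: opacity needs the PROGRESSIVE responses of the remaining
bonds of `K` not to be screened by the part already deleted (triage r1-1 flank (R)); no rigorous RG for
an extended porous defect exists, and the tree has no LOWER bound on a thermal response at `β_c` in
`d = 3`.  Complies with the barriers for the right reason: false in a massive phase (`RandomClusterFirstOrder`),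
marginal in `d = 4`, false in `d ≥ 5` and for `α < 3/2` long-range (`2 − η` vs `Δ_ε = d − 2`).
[card cluster-hole-opacity §(4)–(5); HouEtAl2018; PolandRychkovVichi2019 (Δ_ε = 1.412625);
AizenmanCMP1982 Prop. 5.3; FriedliVelenik2017 §3.8 (GKS), Exercise 3.31.] -/
theorem stub_thickHolesOpaque :
    ∃ c : ℝ, 0 < c ∧ ∀ l : ℕ, 1 ≤ l → ∃ N₀ : ℕ, ∀ N : ℕ, N₀ ≤ N → ∀ a : Fin 4 → ↥(box 3 N),
      (∀ i, ((a i : Site 3)) = (l : ℤ) • tetra i) → ∀ K : Set ↥(box 3 N),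
        IsThick l (Subtype.val '' K) →
          isingTwoPoint (holedGraph (boxGraph N) K) univ (criticalBeta 3) 0 .free (a 2) (a 3) ≤
            (1 - c) * isingTwoPoint (boxGraph N) univ (criticalBeta 3) 0 .free (a 2) (a 3) := by
  sorry

/-- STUB HOLE-LOWER (bookkeeping, closed form; lands with the vocabulary file
`Theorems/FKParityRobustnessFKFourConnectivityDefs.lean`) — the hole event of any vertex set is
decreasing (`isLowerSet_hole`): the monotonicity through which the FKG mixed form
`rcMeasure_real_inter_le_of_isLowerSet` bounds the holed connection probability off thick clusters. -/
theorem stub_holeLower : ∀ (V : Type) (K : Set V), IsLowerSet (hole K) := by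
  sorry

/-! ### Consistency: each named statement IS its registered stub (definitionally) -/

theorem holeLower_holds : ∀ (V : Type) (K : Set V), IsLowerSet (hole K) := stub_holeLower
theorem peelIdentity_holds : PeelIdentity := stub_peel
theorem holeDictionary_holds : HoleDictionary := stub_holeDictionary
theorem thickCluster_holds : ThickCluster := stub_thickCluster
theorem thickHolesOpaque_holds : ThickHolesOpaque := stub_thickHolesOpaque

/-! ### Name-keyed aliases of the statements (the hypotheses of the composition) -/
namespace Registered

/-- Alias of `PeelIdentity` keyed by the registered stub name. -/
abbrev stub_peel : Prop := PeelIdentity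
/-- Alias of `HoleDictionary` keyed by the registered stub name. -/
abbrev stub_holeDictionary : Prop := HoleDictionary
/-- Alias of `ThickCluster` keyed by the registered stub name. -/
abbrev stub_thickCluster : Prop := ThickCluster
/-- Alias of `ThickHolesOpaque` keyed by the registered stub name. -/
abbrev stub_thickHolesOpaque : Prop := ThickHolesOpaque
/-- Alias of the bookkeeping statement "holes are decreasing events" keyed by the registered stub name. -/
abbrev stub_holeLower : Prop := ∀ (V : Type) (K : Set V), IsLowerSet (hole K)

end Registered

/-! ### The composition: the four stubs imply the crux, by name (real proof, no `sorry`) -/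

/-- `FKFourConnectivity` from the stubs.  Constants: `c := c₁·c₂` (THICK's `c₁`, OPAQUE's `c₂`),
`N₀ := max N₀^{THICK} N₀^{OPAQUE}`.  At `(N, a)`, with `φ = fkBox N`, `Gᵢⱼ = φ(aᵢ↔aⱼ)`,
`T = thickEvent l N a₀`, `s = φ(01 ∧ 23 ∧ 0↮2)`:
`P4 + s ≥ φ(01 ∧ 23) ≥ G₀₁G₂₃` (hub inclusion + subadditivity; FKG), `s = ∫ 1_{01}·ratio` (PEEL),
`ratio(ω) = ⟨σ₂σ₃⟩_{holed C_ω(a₀)}` (DICT) `≤ (1−c₂)G₂₃` on `T` (OPAQUE at `K = C_ω(a₀)`, Edwards–Sokal) and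
`≤ G₂₃` off `T` (FKG mixed form for the decreasing hole event), so term by term in the finite sum
`∫ 1_{01}·ratio ≤ G₂₃·(G₀₁ − c₂·φ(01 ∩ T)) ≤ G₂₃·(G₀₁ − c₂c₁G₀₁)` (THICK), i.e. `P4 ≥ c₁c₂·G₀₁G₂₃`. -/
theorem FKFourConnectivity_of (hPeel : Registered.stub_peel) (hDict : Registered.stub_holeDictionary)
    (hThick : Registered.stub_thickCluster) (hOpq : Registered.stub_thickHolesOpaque)
    (hHole : Registered.stub_holeLower) :
    Summit.CriticalPhenomena.Ising3DConformalLimit.Theses.FKParityRobustness.FKFourConnectivity := by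
  obtain ⟨c₁, hc₁, hT⟩ := hThick
  obtain ⟨c₂, hc₂, hO⟩ := hOpq
  unfold Summit.CriticalPhenomena.Ising3DConformalLimit.Theses.FKParityRobustness.FKFourConnectivity
  intro tetra'
  refine ⟨c₁ * c₂, mul_pos hc₁ hc₂, fun l hl => ?_⟩
  obtain ⟨N₁, hN₁⟩ := hT l hl
  obtain ⟨N₂, hN₂⟩ := hO l hl
  refine ⟨max N₁ N₂, fun N hN a ha => ?_⟩
  have hTa := hN₁ N (le_of_max_le_left hN) a ha
  have hOa := hN₂ N (le_of_max_le_right hN) a ha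
  -- parameters of the critical FK-Ising box measure
  have hβ : 0 ≤ criticalBeta 3 := criticalBeta_nonneg 3
  have hp : fkIsingParam (criticalBeta 3) ∈ Set.Icc (0 : ℝ) 1 := fkIsingParam_mem_Icc hβ
  have hp' : fkIsingParam (criticalBeta 3) ∈ Set.Ico (0 : ℝ) 1 := by
    refine ⟨hp.1, ?_⟩
    have hexp := Real.exp_pos (-2 * criticalBeta 3)
    simp only [fkIsingParam]
    linarith
  have hq : (0 : ℝ) < 2 := two_pos
  have hq1 : (1 : ℝ) ≤ 2 := one_le_two
  haveI : IsProbabilityMeasure (fkBox N) := isProbabilityMeasure_rcMeasure (boxGraph N) hp hq ∅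
  have hinj : Function.Injective a := tetra_injective hl a ha
  have h23 : a 2 ≠ a 3 := hinj.ne (by decide)
  -- Step A (FKG, landed Negative lemma): G₀₁·G₂₃ ≤ φ(01 ∧ 23)
  have hA : (fkBox N).real (openConn (a 0) (a 1)) * (fkBox N).real (openConn (a 2) (a 3)) ≤
      (fkBox N).real (openConn (a 0) (a 1) ∩ openConn (a 2) (a 3)) :=
    pairProduct_le_pairJoined (boxGraph N) hp hq1 ∅ a
  -- Step B (hub inclusion + subadditivity): φ(01 ∧ 23) ≤ P4 + s
  have hB : (fkBox N).real (openConn (a 0) (a 1) ∩ openConn (a 2) (a 3)) ≤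
      (fkBox N).real {ω | ∀ i j, (openGraph ω).Reachable (a i) (a j)} +
        (fkBox N).real (openConn (a 0) (a 1) ∩ openConn (a 2) (a 3) ∩ (openConn (a 0) (a 2))ᶜ) := by
    have hsub : openConn (a 0) (a 1) ∩ openConn (a 2) (a 3) ⊆
        {ω | ∀ i j, (openGraph ω).Reachable (a i) (a j)} ∪
          (openConn (a 0) (a 1) ∩ openConn (a 2) (a 3) ∩ (openConn (a 0) (a 2))ᶜ) := by
      intro ω hω
      by_cases h02 : ω ∈ openConn (a 0) (a 2)
      · left
        have h01 : (openGraph ω).Reachable (a 0) (a 1) := hω.1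
        have h23' : (openGraph ω).Reachable (a 2) (a 3) := hω.2
        have h02' : (openGraph ω).Reachable (a 0) (a 2) := h02
        refine allJoined_of_hub fun i => ?_
        fin_cases i
        · exact SimpleGraph.Reachable.refl _
        · exact h01
        · exact h02'
        · exact h02'.trans h23'
      · right
        exact ⟨hω, h02⟩
    calc (fkBox N).real (openConn (a 0) (a 1) ∩ openConn (a 2) (a 3))
        ≤ (fkBox N).real ({ω | ∀ i j, (openGraph ω).Reachable (a i) (a j)} ∪
            (openConn (a 0) (a 1) ∩ openConn (a 2) (a 3) ∩ (openConn (a 0) (a 2))ᶜ)) :=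
          measureReal_mono hsub (measure_ne_top _ _)
      _ ≤ _ := measureReal_union_le _ _
  -- Step C (PEEL): s = ∫ 1_{01} · ratio
  have hC : (fkBox N).real (openConn (a 0) (a 1) ∩ openConn (a 2) (a 3) ∩ (openConn (a 0) (a 2))ᶜ) =
      ∫ ω, (openConn (a 0) (a 1)).indicator
        (fun ω => (fkBox N).real (openConn (a 2) (a 3) ∩ hole (openCluster ω (a 0))) /
          (fkBox N).real (hole (openCluster ω (a 0)))) ω ∂(fkBox N) :=
    hPeel ↥(box 3 N) (boxGraph N) (fkIsingParam (criticalBeta 3)) 2 hp' hq (a 0) (a 1) (a 2) (a 3) h23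
  -- Step D (DICT + OPAQUE on thick clusters, FKG mixed form off them; term by term in the finite sum)
  have e23 : isingTwoPoint (boxGraph N) univ (criticalBeta 3) 0 .free (a 2) (a 3) =
      (fkBox N).real (openConn (a 2) (a 3)) :=
    edwardsSokal_twoPoint_holds (boxGraph N) hβ (a 2) (a 3)
  have hD : ∫ ω, (openConn (a 0) (a 1)).indicator
        (fun ω => (fkBox N).real (openConn (a 2) (a 3) ∩ hole (openCluster ω (a 0))) /
          (fkBox N).real (hole (openCluster ω (a 0)))) ω ∂(fkBox N) ≤
      (fkBox N).real (openConn (a 2) (a 3)) *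
        ((fkBox N).real (openConn (a 0) (a 1)) -
          c₂ * (fkBox N).real (openConn (a 0) (a 1) ∩ thickEvent l N (a 0))) := by
    have hInt : ∫ ω, (openConn (a 0) (a 1)).indicator
          (fun ω => (fkBox N).real (openConn (a 2) (a 3) ∩ hole (openCluster ω (a 0))) /
            (fkBox N).real (hole (openCluster ω (a 0)))) ω ∂(fkBox N) =
        ∑ ω ∈ (boxGraph N).edgeFinset.powerset,
          rcWeight (boxGraph N) (fkIsingParam (criticalBeta 3)) 2 ∅ ω /
              rcPartitionFunction (boxGraph N) (fkIsingParam (criticalBeta 3)) 2 ∅ *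
            (openConn (a 0) (a 1)).indicator
              (fun ω => (fkBox N).real (openConn (a 2) (a 3) ∩ hole (openCluster ω (a 0))) /
                (fkBox N).real (hole (openCluster ω (a 0)))) (↑ω : BondConfig ↥(box 3 N)) :=
      integral_rcMeasure (boxGraph N) hp hq ∅ _
    have h01 : (fkBox N).real (openConn (a 0) (a 1)) =
        ∑ ω ∈ (boxGraph N).edgeFinset.powerset,
          if (↑ω : BondConfig ↥(box 3 N)) ∈ openConn (a 0) (a 1) then
            rcWeight (boxGraph N) (fkIsingParam (criticalBeta 3)) 2 ∅ ω /
              rcPartitionFunction (boxGraph N) (fkIsingParam (criticalBeta 3)) 2 ∅ else 0 :=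
      rcMeasure_real_apply (boxGraph N) hp hq ∅ _
    have h01T : (fkBox N).real (openConn (a 0) (a 1) ∩ thickEvent l N (a 0)) =
        ∑ ω ∈ (boxGraph N).edgeFinset.powerset,
          if (↑ω : BondConfig ↥(box 3 N)) ∈ openConn (a 0) (a 1) ∩ thickEvent l N (a 0) then
            rcWeight (boxGraph N) (fkIsingParam (criticalBeta 3)) 2 ∅ ω /
              rcPartitionFunction (boxGraph N) (fkIsingParam (criticalBeta 3)) 2 ∅ else 0 :=
      rcMeasure_real_apply (boxGraph N) hp hq ∅ _
    rw [hInt, h01, h01T, Finset.mul_sum, mul_sub, Finset.mul_sum, Finset.mul_sum,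
      ← Finset.sum_sub_distrib]
    refine Finset.sum_le_sum fun ω _ => ?_
    have hw : 0 ≤ rcWeight (boxGraph N) (fkIsingParam (criticalBeta 3)) 2 ∅ ω /
        rcPartitionFunction (boxGraph N) (fkIsingParam (criticalBeta 3)) 2 ∅ :=
      div_nonneg (rcWeight_nonneg (boxGraph N) hp hq.le ∅ ω)
        (rcPartitionFunction_pos (boxGraph N) hp hq ∅).le
    by_cases h1 : (↑ω : BondConfig ↥(box 3 N)) ∈ openConn (a 0) (a 1)
    · by_cases h2 : (↑ω : BondConfig ↥(box 3 N)) ∈ thickEvent l N (a 0)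
      · -- thick cluster: DICT + OPAQUE + Edwards–Sokal
        rw [if_pos h1, if_pos ⟨h1, h2⟩, Set.indicator_of_mem h1]
        have hdict := hDict ↥(box 3 N) (boxGraph N) (criticalBeta 3) hβ
          (openCluster (↑ω : BondConfig ↥(box 3 N)) (a 0)) (a 2) (a 3)
        have hopq := hOa (openCluster (↑ω : BondConfig ↥(box 3 N)) (a 0)) h2
        rw [e23] at hopq
        rw [hdict]
        calc rcWeight (boxGraph N) (fkIsingParam (criticalBeta 3)) 2 ∅ ω /
              rcPartitionFunction (boxGraph N) (fkIsingParam (criticalBeta 3)) 2 ∅ *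
              isingTwoPoint (holedGraph (boxGraph N) (openCluster (↑ω : BondConfig ↥(box 3 N)) (a 0)))
                univ (criticalBeta 3) 0 .free (a 2) (a 3)
            ≤ rcWeight (boxGraph N) (fkIsingParam (criticalBeta 3)) 2 ∅ ω /
                rcPartitionFunction (boxGraph N) (fkIsingParam (criticalBeta 3)) 2 ∅ *
                ((1 - c₂) * (fkBox N).real (openConn (a 2) (a 3))) :=
              mul_le_mul_of_nonneg_left hopq hw
          _ = _ := by ring
      · -- thin cluster: the hole only lowers the connection probability (FKG, mixed form)
        rw [if_pos h1, if_neg (fun h => h2 h.2), Set.indicator_of_mem h1]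
        have hmix := rcMeasure_real_inter_le_of_isLowerSet (boxGraph N) hp hq1 ∅
          (isUpperSet_openConn (a 2) (a 3))
          (hHole ↥(box 3 N) (openCluster (↑ω : BondConfig ↥(box 3 N)) (a 0)))
        have hratio : (fkBox N).real (openConn (a 2) (a 3) ∩
              hole (openCluster (↑ω : BondConfig ↥(box 3 N)) (a 0))) /
            (fkBox N).real (hole (openCluster (↑ω : BondConfig ↥(box 3 N)) (a 0))) ≤
            (fkBox N).real (openConn (a 2) (a 3)) :=
          div_le_of_le_mul₀ measureReal_nonneg measureReal_nonneg hmix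
        calc rcWeight (boxGraph N) (fkIsingParam (criticalBeta 3)) 2 ∅ ω /
              rcPartitionFunction (boxGraph N) (fkIsingParam (criticalBeta 3)) 2 ∅ *
              ((fkBox N).real (openConn (a 2) (a 3) ∩
                  hole (openCluster (↑ω : BondConfig ↥(box 3 N)) (a 0))) /
                (fkBox N).real (hole (openCluster (↑ω : BondConfig ↥(box 3 N)) (a 0))))
            ≤ rcWeight (boxGraph N) (fkIsingParam (criticalBeta 3)) 2 ∅ ω /
                rcPartitionFunction (boxGraph N) (fkIsingParam (criticalBeta 3)) 2 ∅ *
                (fkBox N).real (openConn (a 2) (a 3)) :=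
              mul_le_mul_of_nonneg_left hratio hw
          _ = _ := by ring
    · -- `a₀ ↮ a₁`: both sides vanish
      rw [if_neg h1, if_neg (fun h => h1 h.1), Set.indicator_of_notMem h1]
      simp
  -- Step E (THICK) and the algebra
  have hE : c₂ * (fkBox N).real (openConn (a 2) (a 3)) * (c₁ * (fkBox N).real (openConn (a 0) (a 1))) ≤
      c₂ * (fkBox N).real (openConn (a 2) (a 3)) *
        (fkBox N).real (openConn (a 0) (a 1) ∩ thickEvent l N (a 0)) :=
    mul_le_mul_of_nonneg_left hTa (mul_nonneg hc₂.le measureReal_nonneg)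
  show c₁ * c₂ * (fkBox N).real (openConn (a 0) (a 1)) * (fkBox N).real (openConn (a 2) (a 3)) ≤
    (fkBox N).real {ω | ∀ i j, (openGraph ω).Reachable (a i) (a j)}
  linarith [hA, hB, hC, hD, hE]

/-- Wiring check: the registered stubs feed `FKFourConnectivity_of` as stated. -/
example : Summit.CriticalPhenomena.Ising3DConformalLimit.Theses.FKParityRobustness.FKFourConnectivity :=
  FKFourConnectivity_of stub_peel stub_holeDictionary stub_thickCluster stub_thickHolesOpaque stub_holeLower

end Summit.CriticalPhenomena.Ising3DConformalLimit.Cruxes.FKFourConnectivity.ClusterHoleOpacity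

end
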